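import Literature.AlgebraicGeometry.Resolution.HilbertSamuelRegular
import Literature.RingTheory.HilbertSamuel.PhiLowerBound
import Literature.RingTheory.HilbertSamuel.PhiAsymptotics
import HarnessLib

/-!
# `H_X(x) ≥ Φ^{(N)}` everywhere, with equality exactly on the regular locus; `X_max` avoids
# `X_reg` unless `X` is regular (CJS 2020, Lemma 2.23, Rem. 2.32, Def. 2.35)

Topic: `Literature/AlgebraicGeometry/Resolution`. With the inequality of CJS Lemma 2.23
(`PhiLowerBound.lean`: `H^{(0)}_𝒪 ≥ Φ^{(dim 𝒪)}`) the Hilbert–Samuel function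
`H_X^N(x) = H^{(N - ψ_X(x))}_{𝒪_{X,x}}` of Def. 2.28 is bounded below by `Φ^{(N)}` at EVERY point of
a locally noetherian scheme (`ψ_X(x) ≤ dim 𝒪_{X,x}`), and by Lemma 2.31
(`HilbertSamuelRegular.lean`) the bound is attained exactly at the regular points. Hence
`Φ^{(N)}` is the least element of `Σ_X` (Rem. 2.32: "`X` is regular if and only if
`Σ_X = {Φ^{(N)}}`"), and a regular point can lie in the Hilbert–Samuel locus `X_max` of Def. 2.35
only if `Σ_X = {Φ^{(N)}}`, i.e. only if `X` is regular: for non-regular `X` the permissible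
centres `D ⊆ X_max` of the canonical resolution sequence (Rem. 6.29) never meet `X_reg`.
PROVED here:

* `Scheme.iterPSum_Phi_le_hsFun` — `Φ^{(N)} ≤ H_X^N(x)` for all `x`;
* `Scheme.hsFun_eq_iterPSum_Phi_iff` — **Lemma 2.31 without dimension hypotheses**:
  `H_X^N(x) = Φ^{(N)} ⟺ x ∈ X_reg ∧ dim 𝒪_{X,x} ≤ N`;
* `Scheme.hsStratumGE_iterPSum_Phi` — `X(≥ Φ^{(N)}) = X`;
* `Scheme.hsValues_eq_singleton_of_mem_hsMaxLocus` — a regular point of `X_max` forces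
  `Σ_X = {Φ^{(N)}}`; `Scheme.isRegular_of_mem_hsMaxLocus_of_mem_regularLocus`;
* `Scheme.hsMaxLocus_subset_compl_regularLocus` — **`X_max ⊆ X ∖ X_reg` for non-regular `X`**.

## Sources

* V. Cossart, U. Jannsen, S. Saito, LNM 2270 (2020), Lemma 2.23, Lemma 2.31, Rem. 2.32,
  Def. 2.35, Rem. 6.29. [CossartJannsenSaito2020]
-/

noncomputable section

open CategoryTheory AlgebraicGeometry TopologicalSpace IsLocalRing
open Literature.RingTheory.HilbertSamuel

namespace Literature.AlgebraicGeometry.Resolution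

universe u

variable {X : Scheme.{u}}

/-- **`Φ^{(N)} ≤ H_X^N(x)` at every point of a locally noetherian scheme** (CJS Lemma 2.23 with
`ψ_X(x) ≤ dim 𝒪_{X,x}`: `H_X^N(x) = H^{(N-ψ)}_𝒪 ≥ Φ^{(N - ψ + dim 𝒪)} ≥ Φ^{(N)}`).
[cite: CossartJannsenSaito2020, Lemma 2.23] -/
theorem Scheme.iterPSum_Phi_le_hsFun [IsLocallyNoetherian X] (N : ℕ) (x : X) :
    iterPSum N Phi ≤ Scheme.hsFun X N x := by
  obtain ⟨d, hd⟩ : ∃ d : ℕ, ringKrullDim (X.presheaf.stalk x) = d :=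
    exists_nat_eq_of_ne_bot_of_ne_top ringKrullDim_ne_bot ringKrullDim_ne_top
  have hψ : Scheme.hsPsi X x ≤ d := Scheme.hsPsi_le x hd
  have h := iterPSum_Phi_le_hilbertSamuelFun (A := X.presheaf.stalk x) hd (Scheme.hsPhi X N x)
  refine le_trans (iterPSum_Phi_mono ?_) h
  show N ≤ N - Scheme.hsPsi X x + d
  omega

/-- **CJS Lemma 2.31, sharp form: `H_X^N(x) = Φ^{(N)}` iff `x` is a regular point with
`dim 𝒪_{X,x} ≤ N`** (no standing hypothesis `dim X ≤ N`: by Lemma 2.23,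
`Φ^{(N)} = H^{(N-ψ)}_𝒪 ≥ Φ^{(N-ψ+dim 𝒪)}` forces `ψ = dim 𝒪 ≤ N`).
[cite: CossartJannsenSaito2020, Lemma 2.31] -/
theorem Scheme.hsFun_eq_iterPSum_Phi_iff [IsLocallyNoetherian X] (N : ℕ) (x : X) :
    Scheme.hsFun X N x = iterPSum N Phi ↔
      x ∈ Scheme.regularLocus X ∧ ringKrullDim (X.presheaf.stalk x) ≤ N := by
  obtain ⟨d, hd⟩ : ∃ d : ℕ, ringKrullDim (X.presheaf.stalk x) = d :=
    exists_nat_eq_of_ne_bot_of_ne_top ringKrullDim_ne_bot ringKrullDim_ne_top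
  have hψ : Scheme.hsPsi X x ≤ d := Scheme.hsPsi_le x hd
  constructor
  · intro h
    have h1 := iterPSum_Phi_le_hilbertSamuelFun (A := X.presheaf.stalk x) hd (Scheme.hsPhi X N x)
    have h2 : iterPSum (Scheme.hsPhi X N x + d) Phi ≤ iterPSum N Phi := h ▸ h1
    have h3 : Scheme.hsPhi X N x + d ≤ N := iterPSum_Phi_le_iff.mp h2
    have hdN : d ≤ N := by
      change N - Scheme.hsPsi X x + d ≤ N at h3
      omega
    refine ⟨(Scheme.mem_regularLocus_iff_hsFun_eq x hd hdN).mpr h, ?_⟩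
    rw [hd]
    exact_mod_cast hdN
  · rintro ⟨hreg, hle⟩
    have hdN : d ≤ N := by
      rw [hd] at hle
      exact_mod_cast hle
    exact Scheme.hsFun_of_mem_regularLocus hreg hd hdN

/-- Hence **`X_reg ∩ {dim ≤ N} = X(Φ^{(N)})`** with no global dimension bound.
[cite: CossartJannsenSaito2020, Rem. 2.32] -/
theorem Scheme.hsStratum_iterPSum_Phi [IsLocallyNoetherian X] (N : ℕ) :
    Scheme.hsStratum X N (iterPSum N Phi) =
      Scheme.regularLocus X ∩ {x | ringKrullDim (X.presheaf.stalk x) ≤ N} :=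
  Set.ext fun x => Scheme.hsFun_eq_iterPSum_Phi_iff N x

/-- `Φ^{(N)}` is a lower bound of `Σ_X`. [cite: CossartJannsenSaito2020, Rem. 2.32] -/
theorem Scheme.iterPSum_Phi_le_of_mem_hsValues [IsLocallyNoetherian X] {N : ℕ} {ν : ℕ → ℕ}
    (hν : ν ∈ Scheme.hsValues X N) : iterPSum N Phi ≤ ν := by
  obtain ⟨x, rfl⟩ := hν
  exact Scheme.iterPSum_Phi_le_hsFun N x

/-- `X(≥ Φ^{(N)}) = X`. [cite: CossartJannsenSaito2020, Def. 2.28 (4)] -/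
theorem Scheme.hsStratumGE_iterPSum_Phi [IsLocallyNoetherian X] (N : ℕ) :
    Scheme.hsStratumGE X N (iterPSum N Phi) = Set.univ :=
  Set.eq_univ_of_forall fun x => Scheme.iterPSum_Phi_le_hsFun N x

/-- **`Φ^{(N)}` is the least element of `Σ_X` as soon as `X` has a regular point of dimension
`≤ N`.** [cite: CossartJannsenSaito2020, Rem. 2.32] -/
theorem Scheme.isLeast_hsValues_iterPSum_Phi [IsLocallyNoetherian X] {N : ℕ} {x : X}
    (hx : x ∈ Scheme.regularLocus X) {d : ℕ} (hd : ringKrullDim (X.presheaf.stalk x) = d)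
    (hdN : d ≤ N) : IsLeast (Scheme.hsValues X N) (iterPSum N Phi) :=
  ⟨⟨x, Scheme.hsFun_of_mem_regularLocus hx hd hdN⟩,
    fun _ hν => Scheme.iterPSum_Phi_le_of_mem_hsValues hν⟩

/-- **A regular point in the Hilbert–Samuel locus forces `Σ_X = {Φ^{(N)}}`**: its value `Φ^{(N)}`
is both maximal and the least element. [cite: CossartJannsenSaito2020, Rem. 2.32, Def. 2.35] -/
theorem Scheme.hsValues_eq_singleton_of_mem_hsMaxLocus [IsLocallyNoetherian X] {N : ℕ} {x : X}
    (hx : x ∈ Scheme.regularLocus X) {d : ℕ} (hd : ringKrullDim (X.presheaf.stalk x) = d)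
    (hdN : d ≤ N) (hmax : x ∈ Scheme.hsMaxLocus X N) :
    Scheme.hsValues X N = {iterPSum N Phi} := by
  have hxv : Scheme.hsFun X N x = iterPSum N Phi := Scheme.hsFun_of_mem_regularLocus hx hd hdN
  refine Set.eq_singleton_iff_unique_mem.mpr ⟨⟨x, hxv⟩, fun ν hν => ?_⟩
  have hmax' : Maximal (· ∈ Scheme.hsValues X N) (iterPSum N Phi) := hxv ▸ hmax
  exact le_antisymm (hmax'.2 hν (Scheme.iterPSum_Phi_le_of_mem_hsValues hν))
    (Scheme.iterPSum_Phi_le_of_mem_hsValues hν)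

/-- **A regular point lies in `X_max` only if `X` is regular** (all local rings of dimension
`≤ N`). [cite: CossartJannsenSaito2020, Rem. 2.32, Def. 2.35] -/
theorem Scheme.isRegular_of_mem_hsMaxLocus_of_mem_regularLocus [IsLocallyNoetherian X] {N : ℕ}
    (hdim : ∀ x : X, ∃ d : ℕ, ringKrullDim (X.presheaf.stalk x) = d ∧ d ≤ N) {x : X}
    (hx : x ∈ Scheme.regularLocus X) (hmax : x ∈ Scheme.hsMaxLocus X N) : Scheme.IsRegular X := by
  obtain ⟨d, hd, hdN⟩ := hdim x
  exact (Scheme.isRegular_iff_hsValues_subset hdim).mpr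
    (Scheme.hsValues_eq_singleton_of_mem_hsMaxLocus hx hd hdN hmax).le

/-- **`X_max ⊆ X ∖ X_reg` for a non-regular scheme** (all local rings of dimension `≤ N`): the
centres of `Σ^{max}`-eliminations and of the canonical resolution sequence, which lie in `X_max`,
avoid the regular locus. [cite: CossartJannsenSaito2020, Def. 2.35, Rem. 6.29] -/
theorem Scheme.hsMaxLocus_subset_compl_regularLocus [IsLocallyNoetherian X] {N : ℕ}
    (hdim : ∀ x : X, ∃ d : ℕ, ringKrullDim (X.presheaf.stalk x) = d ∧ d ≤ N)
    (hX : ¬Scheme.IsRegular X) : Scheme.hsMaxLocus X N ⊆ (Scheme.regularLocus X)ᶜ :=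
  fun _ hmax hreg => hX (Scheme.isRegular_of_mem_hsMaxLocus_of_mem_regularLocus hdim hreg hmax)

end Literature.AlgebraicGeometry.Resolution

end
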